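import Summits.ResolutionOfSingularities.ResolutionOfSingularities.Theorems.WildDescent13
import Summits.ResolutionOfSingularities.ResolutionOfSingularities.Theorems.WallFrames16
import HarnessLib

/-!
# WildDescent (14/13 + 1, rider) — the column aside `MaxContactCut.DefectWalksDeep` (31770) is EXACTLY lens-3's LOSSY cell,
hypothesis-free

Critic row 230, WINDOW g37 (1): «rider `WildDescent14.lean` with `defectWalksDeep_iff_lossy : DefectWalksDeep ↔
NoLossyStrictTailsDeep` hyp-free AFTER WallFrames16 lands = bookkeeping 0, banked, landable».  `WallFrames16` is in the
tree (`WallFrames.balancedWallPort_holds : WallCut.BalancedWallPort`, p827781), so the port hypothesis of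
`WildDescent.defectWalksDeep_iff_lossy_of_port` (slice 13) is discharged BY NAME.  No new mathematics.

Landing: `Theorems/WildDescent14.lean`, AFTER `Theorems/WildDescent13.lean` accepts; `--kind proof --supports
stmt-ResolutionOfSingularities-31770`.  (Sources: CossartJannsenSaito2020 §§10–12; Kollar2007 2.59.)
-/

namespace Summit.ResolutionOfSingularities.ResolutionOfSingularities.Theorems.WildDescent

section ColumnHypFree

open Summit.ResolutionOfSingularities.ResolutionOfSingularities.Theses
open Summit.ResolutionOfSingularities.ResolutionOfSingularities.Theorems

/-- **31770 RE-LOCATED, hypothesis-free:** `MaxContactCut.DefectWalksDeep ⟺ WallCut.NoLossyStrictTailsDeep` — the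
|σ| = 3 model column's located residual is EXACTLY the LOSSY strict cell (27367).  [new; composition of slice 13 with
`WallFrames.balancedWallPort_holds`] -/
theorem defectWalksDeep_iff_lossy : MaxContactCut.DefectWalksDeep ↔ WallCut.NoLossyStrictTailsDeep :=
  defectWalksDeep_iff_lossy_of_port WallFrames.balancedWallPort_holds

/-- The LOSSY strict cell alone closes the host aside 31770, hypothesis-free in everything else. [new; composition] -/
theorem defectWalksDeep_of_lossy' (h : WallCut.NoLossyStrictTailsDeep) : MaxContactCut.DefectWalksDeep :=
  defectWalksDeep_iff_lossy.mpr h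

/-- Conversely the host aside implies the LOSSY cell (necessity, for the record). [new; composition] -/
theorem lossy_of_defectWalksDeep (h : MaxContactCut.DefectWalksDeep) : WallCut.NoLossyStrictTailsDeep :=
  defectWalksDeep_iff_lossy.mp h

end ColumnHypFree

end Summit.ResolutionOfSingularities.ResolutionOfSingularities.Theorems.WildDescent
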